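import Summits.HodgeConjecture.HodgeConjecture.Theorems.F0P6aSpecOrgans
import HarnessLib
import HarnessLib.Audit.LibrarySuggestionsDenyListCruxes

/-!
# F0_P6a_SpecOrgans — ED. 4 = SHIM (K6 L2 column re-home, wave 2; pen LA2-plan (g5) PLAN «L2 cone RE-HOME» v1.4 + Addendum 3 (d1); ★ parts by LA2-p02 (g5) R1, PRE-CURED (d1) set v3d1; box LAref-D (g4) first ∕ LA-ref1 (g5) second; template LA2-p03 (g7) v1tmpl 7b1135ec, docstring re-trued for v3d1 by the pen (v2tmpl) — the LEAD composes the K6 shim request, not L2)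

Eighteen of the twenty-two declarations of the tree workfile `Lines/F0_P6a_SpecOrgans.lean` (ED. 3, sha16 f8c3b4bc8f4404ac, 1323 l., sorry-free, stub-free; 22 theorems + 0 def-like)
now live, statement for statement and under the SAME namespace `Summit.HodgeConjecture.HodgeConjecture.Cruxes.HLiu418.F0P6aLineSpecialisation`, in the ★ chain
★ `Theorems/F0P6aSpecOrgansBlockC.lean` (p853099) → ★ `Theorems/F0P6aSpecOrgansBlockI.lean` (p853119) → ★ `Theorems/F0P6aSpecOrgansTwoQuotLegs.lean` (p853155) → ★ `Theorems/F0P6aSpecOrgansHrkG.lean` (p853191) → ★ `Theorems/F0P6aSpecOrgans.lean` (p853234) (LAST part = plain stem; each part imports the previous):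
`map_restrictPt_section_eq_of_untwist`, `red₀Of_eq_of_structuredIso₀_serre`, `red₀Of_eq_of_common_source_serre`, `rosati_baseChange₀`, `lag_of_quotLeg`, `dockPt_of_fixed`, `real_comp_of_quotLeg`,
`comp_eq_one_iff_of_two_quotLegs_of_cut_aux`, `comp_eq_one_iff_of_two_quotLegs_of_cut`, `comp_eq_one_iff_of_two_quotLegs`, `hrkG_of_dock`, `baseChangeHom₂_comp_eq_i`, `exists_returnMap₀_of_mem`,
`mono_coverPin₀`, `isMonHom_coverPin₀`, `exists_isogW₀_of_quotLeg`, `isogW₀_kills_of_quotLeg`, `le_ker_isogW₀_of_himg` (order preserved; six proof bodies re-spelled at seven call sites, statements unchanged).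
The other FOUR — ED. 3՚s by-copy restatements of ★ Literature theorems, §QuotWDCore :402∕:430∕:443 and :1072 — were DELETED in the ★ twin under the LEAD՚s «M-142e» class (d1) «dedup.landed» cure
and resolve at their ★ homes: `Literature.AlgebraicGeometry.GroupSchemes.AffineGroupScheme.comp_eq_one_iff_of_blocks` ∕ `.exists_comp_eq_comp_of_equivariant` ∕ `.exists_comp_iff_of_dock`
(`Literature/AlgebraicGeometry/GroupSchemes/KernelEqOfLagrangianBlocks.lean` :70∕:98∕:111) and `Literature.NumberTheory.NumberFields.exists_mem_add_mem_eq_one_of_ne`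
(`Literature/NumberTheory/NumberFields/GaloisConjugatePrimeIdealArithmetic.lean` :83); both modules are imported by ★ part 1, hence re-exported here. No tree file reads the four deleted
names through this module (`rg -w` over `Cruxes/HLiu418/Lines` + `Theorems` at 00:50Z 09-03: the only reader, `Lines/F0_P6a_SpecOrgansU.lean` :841, already spells `AffineGroupScheme.comp_eq_one_iff_of_blocks`
over its own import of the ★ home) ⇒ CLOSURE-NAMES contribution of the (d1) cure = ∅ and nothing to alias; this module keeps its name so that its tree importer (`Lines/F0_P6a_SpecOrgansT.lean`)
and any by-name reader under `open …F0P6aLineSpecialisation` resolve the eighteen unchanged through the import above.  It declares nothing.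
ORDER NOTE: written on the LEAD՚s wave word after EVERY ★ part above is ACCEPTED and served (NO-CROSS-IMPORT: no environment may hold a `Lines/` ORIGINAL of this column together with its ★ twin);
an importer smoke that reads «environment already contains …» before the wave՚s request is BUILT is this order note, not a defect.  Edition history stays in the line card
`Lines/F0_P6a_SpecOrgans.md` and in git; future changes are ★-side proposals on the `Theorems/` files.
HC_CM is proved only modulo the 7 printed citations (2 remaining named inputs: hLiu418 = stmt-HodgeConjecture-24832, h413 = stmt-HodgeConjecture-24833) until rung 0 closes; count-neutral (0 `sorry`, 0 socket, 0 declarations). -/
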